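import Literature.MathematicalPhysics.QuantumFieldTheory.MullerSchiemann1987.MS87CentralAngleExpansion
import Literature.MathematicalPhysics.QuantumFieldTheory.MullerSchiemann1987.MS87Theorem2Part3
import HarnessLib

/-!
# Müller–Schiemann, *Continuum limit of a hierarchical SU(2) lattice gauge theory in 4 dimensions*
# (CMP 110, 1987), Sect. 4 pp.274–275: THE SMALL-FIELD INPUTS OF THE NONPERTURBATIVE END — (4.53) from (A₃),
# (4.54) for `θ²`, (4.56) from (A₂), (4.57), (4.58), (4.60) ⟹ (4.61), and the first line of (4.59) pointwise —
# DISCHARGED from the induction hypotheses and Proposition 1, with every `𝒪` an explicit constant; (v1.1) + (4.7)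
# p.269, the small-field domain `|θ²(v, ±z/2)| < β^{−2α}` in which `K(z)` is analysed
# (theorems only; no definition, no named fact)

statement-level skeleton of published theorems with citation tags; proofs where landed; nothing here is a claim about the Yang–Mills mass gap

[MullerSchiemann1987] V. F. Müller, J. Schiemann, Commun. Math. Phys. **110** (1987) 261–286, Sect. 4 «Reproduction of
the Small Field Assumptions», its nonperturbative end pp.273–275, displays (4.53)–(4.61); Sect. 3 p.267 (A₂), (A₃);
Sect. 2 (2.13) and Proposition 1 p.264, (2.17)–(2.19) p.265; Sect. 5 p.276 L.22–25 with (5.15)–(5.16). Read by this seat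
on its own 3× page renders of the journal scan (`renders-cmp110ms/`, PDF page = journal page − 260: pp.264–267 = PDF 4–7,
pp.274–276 = PDF 14–16). Lean lane of the lit-balaban YM LIT SWEEP CONTEXT row X1 (register
`MullerSchiemann1987/`); the model is the `d = 4` HIERARCHICAL `SU(2)` gauge model (Migdal's recursion as an exact
renormalization group), NOT lattice Yang–Mills. Sibling of `MS87NonperturbativeContributionL` — which proves the
exponent bookkeeping (4.59), (4.62)–(4.64) with the displayed relations (4.53), (4.56), (4.57), (4.58), (4.61) AS
HYPOTHESES (its `h457`, `h458`, the `Dβ^{1−4α}` of (4.53)/(4.61)) — and of `MS87CentralAngleExpansion`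
(`ThetaSqExpansion.re_thetaSq_mul_I`: (5.15)/(5.16)/(4.60) quantitatively, under the hypothesis `(1 − w₀) + t² ≤ ¼`
which, as that file declares, «replaces |θ_j²| < β^{−2α}, |y| < ½κ(β′)^{−α}»). THIS FILE SUPPLIES THOSE HYPOTHESES from
the induction assumptions (A₂), (A₃) of Sect. 3 and Proposition 1, i.e. it discharges the small-field inputs of the
nonperturbative estimates at the level the print states them, with every `𝒪(β^{−4α})`, `𝒪(β^{1−4α})` an explicit constant.

**What the paper prints.** p.269: *«Let ξ, ξ′ be fixed positive numbers with 0 < ξ′ < ξ ≦ ¼. (4.1) Denoting by χ(v)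
the characteristic function of 𝒢[0, ξ′β^{−α}] ⊂ G, see (2.19), i.e. χ(v) = χ(v; 0, ξ′β^{−α}), (4.2) … We first analyze K(z)
in the extended domain, z ∈ ℂ, |z| < 2(1 − ξ)β^{−α}. (4.6) For β sufficiently large, (4.1), (4.6) and χ(v) = 1 imply with
(2.13), |θ²(v, ±z/2)| < β^{−2α}. (4.7) Thus we can use the assumption (A₃) together with Proposition 1»*. (A₃) p.267: *«(A₃) Small Field. In the domain z ∈ ℂ, |z| < β^{−α}, there exists a
holomorphic function V(z) such that h(z) = exp{−V(z)}, V(z) = βz² + ½λz⁴ + ⅓σz⁶ + Ṽ(z), Ṽ(z) = 𝒪(z⁸). β ∈ ℝ₊ is large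
and |β^{−1}λ|, |β^{−1}σ| are bounded by constants. Moreover the bound |Ṽ(z)| < Dβ^{−2} holds in the domain, with a
constant D.»*; (A₂) p.267: *«For y ∈ ℝ, |y| < (κ/2)β^{−α} and u ∈ G∖𝒢[iy, β^{−α}], |g̃(u, iy)| < exp{βy² − pβ^{1−2α}}, with
1 < κ < 1 + ε (ε > 0 small) and ½ < p < 1 − κ²/4.»*; (2.18)–(2.19) p.265: `𝒢[z, ϱ] = {u : u₀ > 0, |θ²(u, z)| < ϱ²}`,
`χ(u; z, ϱ)` its characteristic function. p.274: *«These integrals are estimated using in the small field region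
|θ| < β^{−α} the assumption (A₃), i.e. h(θ) = exp{−βθ² + 𝒪(β^{1−4α})}. (4.53) Moreover, due to the symmetry property
(2.8), we have g̃(v, ±z/2) = g̃(e^{∓i(x/2)σ₃}v, ±iy/2), θ²(v, ±z/2) = θ²(e^{∓i(x/2)σ₃}v, ±iy/2), (where defined) (4.54)
such that χ± = χ(e^{∓i(x/2)σ₃}v; ±iy/2, β^{−α}). (4.55) Recalling |y/2| < ½(β′)^{−α} < (κ/2)β^{−α}, we can thus use in
the supports of 1 − χ± the bound of assumption (A₂), which yields |g̃(v, ±z/2)| ≦ exp{−pβ^{1−2α} + β(y/2)²}. (4.56)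
Treating I⁽¹⁾ first we easily deduce from (4.12), (4.13) for |θ±| < β^{−α} and |z| < (β′)^{−α},
θ₊² + θ₋² = 4w + ½z² + 𝒪(β^{−4α}). (4.57) The support of 1 − χ(v) implies w = 1 − v₀ ≧ ½(ξ′β^{−α})² + 𝒪(β^{−4α}).
(4.58) Hence we obtain |I⁽¹⁾| ≦ ∫dv[1 − χ(v)]χ₊χ₋ exp{−4βw − (β/2)(x² − y²) + 𝒪(β^{1−4α})} < … (4.59)»*; p.275:
*«From (4.54) and (2.14) we derive for |θ±| < β^{−α} and |z| < (β′)^{−α}, Re θ±² = 2[1 − (e^{∓i(x/2)σ₃}v)₀]cosh(y/2)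
− (y/2)² + 𝒪(β^{−4α}), (4.60) and hence, due to (4.53) |h(θ±)| < exp{β(y/2)² + 𝒪(β^{1−4α})}. (4.61)»*; p.276 L.22–25:
*«In this region we can use (4.53). From the definition (2.13) we deduce for |θ_j²| < β^{−2α}, j = 1, 2, and
|y| < ½κ(β′)^{−α}, Re θ₁² = 2[1 − (uv⁻¹)₀] − ¼y² + 𝒪(β^{−4α}) (5.15)»*.

**What this file proves (kernel-checked, 0 sorry, standard axioms; theorems only, no definition, no named fact).**
With the siblings' `u0`, `u3`, `diagPhase x = e^{−ixσ₃}`, `etaOf u z = ½{1 − u₀ cos z − u₃ sin z}`,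
`thetaSq u z = θ²(u, z) = 4f(η)` (2.13), `regionG z ϱ = 𝒢[z, ϱ]` (2.18), `centralAngle`:
* §1 **(4.53) FROM (A₃)** (`eq453`): if `h = e^{−V}`, `V = βθ² + ½λθ⁴ + ⅓σθ⁶ + Ṽ`, `|Ṽ| ≤ Dβ^{−2}`, `|λ| ≤ c_λβ`,
  `|σ| ≤ c_σβ`, `|θ| ≤ β^{−α}`, `β ≥ 1`, `α ≥ 0`, then `h = exp{−βθ² + E}` with
  **`|E| ≤ (½c_λ + ⅓c_σ)β^{1−4α} + Dβ^{−2}`**; in modulus `e^{−βRe θ² − C} ≤ |h| ≤ e^{−βRe θ² + C}`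
  (`eq453_norm_le`, `eq453_norm_ge`) — the shape `|h(θ)| ≤ exp{−βRe θ² + E}` in which the siblings
  `MS87Eq517FirstLine` (`h453`) and `MS87NonperturbativeContributionL` consume (4.53).
* §2 **«|θ²| < β^{−2α} ⟹ 1 − w₀ = 𝒪(β^{−2α})»** (the regime statement of (5.15)/(5.16) and (4.60)): by Proposition 1's
  inversion `C(θ²) = 1 − 2η` (`CentralAngle.cosSq_four_fC`) and `|cos θ − (1 − θ²/2)| ≤ (5/96)|θ|⁴`,
  `|η| ≤ ¼|θ²| + (5/192)|θ²|²` for `|η| < 1`, `|θ²| ≤ 1` (`norm_etaOf_le_of_thetaSq`); on the imaginary axis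
  `1 − w₀ ≤ 2|η(w, it)| + (cosh t − 1)` (`one_sub_u0_le`), hence for `w₀ > −½`, `|t| < ¼`, `|θ²(w, it)| ≤ ϱ² ≤ 1`:
  **`(1 − w₀) + t² ≤ (53/96)ϱ² + 2t²`** (`s_le`) — the hypothesis of the sibling's (5.15)/(5.16)/(4.60).
* §3 **(4.60) ⟹ (4.61)**: in that regime with `t² ≤ (κ/2)²ϱ²` and `Aϱ² ≤ ¼`, `A := 53/96 + κ²/2`:
  `Re θ²(w, it) ≥ −t² − 7A²ϱ⁴` (`re_thetaSq_ge`), and with (4.53) in modulus form and `ϱ = β^{−α}`: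
  **`|h(θ)| ≤ exp{βt² + 7A²β^{1−4α} + E}`** (`eq461`) — (4.61) with `t = y/2`, its `𝒪(β^{1−4α})` explicit.
* §4 **(4.54) for `θ²` and `g̃`, (4.56)**: `θ²(e^{−isσ₃}u, z′) = θ²(u, s + z′)` (`thetaSq_diagPhase_mul`), so
  `θ²(v, ±z/2) = θ²(e^{∓i(x/2)σ₃}v, ±iy/2)` (`eq454_plus/minus`) and the same for any `g̃` with (2.8) (`eq454_gt`);
  (4.56) is (A₂) at `y/2` once `|y| < (β′)^{−α} ≤ κβ^{−α}` (`eq456`).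
* §5 **(4.58)**: `v ∉ 𝒢[0, ϱ′]`, `0 ≤ ϱ′ ≤ 1` ⟹ **`w = 1 − v₀ ≥ ½ϱ′² − (5/96)ϱ′⁴`** (`eq458`; `θ²(v, 0) = θ(v)²` with the
  real central angle, `cos` decreasing on `[0, π]`, `1 − cos ϱ′ ≥ ½ϱ′² − (5/96)ϱ′⁴`); with `ϱ′ = ξ′β^{−α}` exactly the
  sibling's `h458` with `D₂ = (5/96)ξ′⁴` (`eq458_beta`).
* §6 **(4.57), REAL PART, ONE-SIDED** (what (4.59) uses): for `e^{∓i(x/2)σ₃}v ∈ 𝒢[±iy/2, ϱ]` (the support of `χ₊χ₋`),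
  `|y/2| < ¼`, `(y/2)² ≤ (κ/2)²ϱ²`, `x² ≤ κ²ϱ²` («|z| < (β′)^{−α} < κβ^{−α}»), `ϱ² ≤ 1`, `Aϱ² ≤ ¼`:
  **`Re(θ₊² + θ₋²) ≥ 4w + ½(x² − y²) − D₃ϱ⁴`**, `D₃ = 14A² + ½Aκ² + (5/384)κ⁴` (`eq457_re_ge`; via (4.54),
  `(e^{∓i(x/2)σ₃}v)₀ = v₀cos(x/2) ± v₃sin(x/2)`, `1 − cos(x/2) ≥ x²/8 − (5/1536)x⁴`, and §2 for `w ≤ Aϱ²`); with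
  `ϱ = β^{−α}` the sibling's `h457` (`eq457_beta`); and **the first line of (4.59) pointwise** (`eq459_pointwise`):
  `|h(θ₊)h(θ₋)| ≤ exp{−4βw − (β/2)(x² − y²) + D₃β^{1−4α} + 2E}`, `E` the constant of (4.53) in modulus form
  (so the print's `𝒪(β^{1−4α})` is `(D₃ + c_λ + ⅔c_σ)β^{1−4α} + 2Dβ^{−2}`).
* §7 (v1.1) **(4.7): `|θ²(v, ±z/2)| < β^{−2α}` for `χ(v) = 1`, `|z| < 2(1 − ξ)β^{−α}`** (`eq47`, `eq47_beta`) — what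
  licenses (A₃) and Proposition 1 inside `K(z)`, (4.8): for `v ∈ 𝒢[0, ξ′ϱ]`, `|ζ| ≤ (1 − ξ)ϱ`, `0 ≤ ξ′ < ξ ≤ 1`, `ϱ ≤ ½`
  and `4ϱ² ≤ ξ − ξ′` («β sufficiently large»): `|θ²(v, ζ)| < ϱ²`. Route — a triangle inequality for the complexified
  central angle: with the real central angle `t = θ(v) < ξ′ϱ` (`cos t = v₀`, `|v₃| ≤ sin t ≤ t`),
  `2η(v, ζ) = (1 − cos ζ) + (1 − v₀)cos ζ − v₃ sin ζ` gives `|η| ≤ ¼S² + ½S⁴`, `S = t + |ζ| < (1 − (ξ − ξ′))ϱ`, and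
  `|θ²| ≤ 4|η| + 8|η|² ≤ S²(1 + 4S²) < ϱ²` (the sibling's `|f(η) − η| ≤ 2|η|²`).

**Readings / scope (declared).** (i) `h`, `V`, `Ṽ`, `λ`, `σ`, `g̃` are letters constrained by the displayed (A₁)-(A₃)
relations, exactly as in the siblings; `θ²` is the sibling's `thetaSq` (no branch of `θ` is chosen; where a `θ` occurs it
is any complex number with the stated `θ²` or `|θ|`). (ii) Every `𝒪` is an explicit nonnegative constant with an
explicit smallness threshold in place of «for β large enough»; the constants are crude (`53/96`, `7A²`, `D₃`), not
optimal. (iii) (4.57) is proved for the real part and as a lower bound — the direction (4.59) consumes; the print's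
`cosh(y/2)` in (4.60) is replaced by the sibling's `cosh`-free main term (the difference is of the absorbed order).
(iv) The hypothesis `w₀ > −½`, `|t| < ¼` (Proposition 1's printed domain, `CentralAngle.norm_etaOf_lt_one`) makes
`|η| < 1` available; inside `𝒢[·, ϱ]` one has `w₀ > 0` anyway.

**Not claimed.** The integrated bounds (4.59), (4.62)–(4.64) (sibling `MS87NonperturbativeContributionL`), (4.46),
(4.8)–(4.11), Theorem 1, anything about lattice Yang–Mills or the Clay problem.
-/

open Complex

namespace Literature.MathematicalPhysics.QuantumFieldTheory

namespace MullerSchiemann1987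

namespace SmallFieldInputs

open HeatKernel (u0 u3 diagPhase abs_u0_le_one u0_sq_add_u3_sq_le_one u0_diagPhase_mul u3_diagPhase_mul
  diagPhase_zero centralAngle centralAngle_eq_arccos_u0)
open CentralAngle (fC etaOf thetaSq cosSq cos_eq_cosSq cosSq_four_fC norm_etaOf_lt_one thetaSq_ofReal)
open ThetaSqExpansion (re_thetaSq_mul_I etaOf_mul_I_re)
open Theorem2Part3 (regionG mem_regionG)

/-! ## §0 Elementary helpers -/

/-- `β · β^{−t} = β^{1−t}` (`β > 0`). [folklore] -/
private theorem mul_rpow_neg {β t : ℝ} (hβ : 0 < β) : β * β ^ (-t) = β ^ (1 - t) := by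
  rw [sub_eq_add_neg, Real.rpow_add hβ, Real.rpow_one]

/-- `(β^{−α})⁴ = β^{−4α}`. [folklore] -/
private theorem rpow_neg_four {β α : ℝ} (hβ : 0 < β) : (β ^ (-α)) ^ 4 = β ^ (-(4 * α)) := by
  rw [← Real.rpow_natCast, ← Real.rpow_mul hβ.le]; ring_nf

/-- `cosh t − 1 ≤ t²` for `|t| ≤ 1` (from `e^s ≤ 1 + s + s²` for `|s| ≤ 1`). [folklore] -/
private theorem cosh_sub_one_le_sq {t : ℝ} (ht : |t| ≤ 1) : Real.cosh t - 1 ≤ t ^ 2 := by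
  have h1 := Real.abs_exp_sub_one_sub_id_le ht
  have h2 := Real.abs_exp_sub_one_sub_id_le (show |-t| ≤ 1 by rwa [abs_neg])
  rw [Real.cosh_eq]
  have := (abs_le.mp h1).2; have := (abs_le.mp h2).2
  nlinarith

/-- Every complex number has a square root. [folklore] -/
private theorem exists_sq_eq (w : ℂ) : ∃ θ : ℂ, θ ^ 2 = w :=
  IsAlgClosed.exists_pow_nat_eq w (by norm_num)

/-! ## §1 (4.53) from (A₃) -/

/-- **(4.53) FROM (A₃)**: «in the small field region |θ| < β^{−α} the assumption (A₃), i.e.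
h(θ) = exp{−βθ² + 𝒪(β^{1−4α})}» — with (A₃) `h = e^{−V}`, `V = βθ² + ½λθ⁴ + ⅓σθ⁶ + Ṽ`, `|Ṽ| ≤ Dβ^{−2}`, `|λ| ≤ c_λβ`,
`|σ| ≤ c_σβ` and `|θ| ≤ β^{−α}` (`β ≥ 1`, `α ≥ 0`): `h = exp{−βθ² + E}`, `|E| ≤ (½c_λ + ⅓c_σ)β^{1−4α} + Dβ^{−2}`.
[cite: MullerSchiemann1987, (4.53) p.274; (A₃) p.267] -/
theorem eq453 {h V Vt lam sig θ : ℂ} {β α D cl cs : ℝ} (hβ : 1 ≤ β) (hα : 0 ≤ α)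
    (hh : h = Complex.exp (-V)) (hV : V = β * θ ^ 2 + lam / 2 * θ ^ 4 + sig / 3 * θ ^ 6 + Vt)
    (hVt : ‖Vt‖ ≤ D * β ^ (-(2:ℝ))) (hlam : ‖lam‖ ≤ cl * β) (hsig : ‖sig‖ ≤ cs * β) (hθ : ‖θ‖ ≤ β ^ (-α)) :
    ∃ E : ℂ, h = Complex.exp (-((β : ℂ) * θ ^ 2) + E) ∧
      ‖E‖ ≤ (cl / 2 + cs / 3) * β ^ (1 - 4 * α) + D * β ^ (-(2:ℝ)) := by
  refine ⟨-(lam / 2 * θ ^ 4 + sig / 3 * θ ^ 6 + Vt), ?_, ?_⟩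
  · rw [hh, hV]; congr 1; ring
  have hβ0 : 0 < β := by linarith
  have hz4 : ‖θ‖ ^ 4 ≤ β ^ (-(4 * α)) := by
    have h4 := pow_le_pow_left₀ (norm_nonneg _) hθ 4
    rwa [rpow_neg_four hβ0] at h4
  have hz6 : ‖θ‖ ^ 6 ≤ β ^ (-(4 * α)) := by
    have h6 := pow_le_pow_left₀ (norm_nonneg _) hθ 6
    rw [← Real.rpow_natCast (β ^ (-α)) 6, ← Real.rpow_mul hβ0.le] at h6
    have : β ^ (-α * ((6:ℕ):ℝ)) ≤ β ^ (-(4 * α)) :=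
      Real.rpow_le_rpow_of_exponent_le hβ (by push_cast; nlinarith)
    exact h6.trans this
  have hF : β * β ^ (-(4 * α)) = β ^ (1 - 4 * α) := mul_rpow_neg hβ0
  have hcl : 0 ≤ cl * β := (norm_nonneg lam).trans hlam
  have hcs : 0 ≤ cs * β := (norm_nonneg sig).trans hsig
  have t2 : ‖lam / 2 * θ ^ 4‖ ≤ cl / 2 * (β * β ^ (-(4 * α))) := by
    rw [norm_mul, norm_div, Complex.norm_ofNat, norm_pow]
    calc ‖lam‖ / 2 * ‖θ‖ ^ 4 ≤ cl * β / 2 * β ^ (-(4 * α)) :=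
          mul_le_mul (by linarith) hz4 (by positivity) (by positivity)
      _ = _ := by ring
  have t3 : ‖sig / 3 * θ ^ 6‖ ≤ cs / 3 * (β * β ^ (-(4 * α))) := by
    rw [norm_mul, norm_div, Complex.norm_ofNat, norm_pow]
    calc ‖sig‖ / 3 * ‖θ‖ ^ 6 ≤ cs * β / 3 * β ^ (-(4 * α)) :=
          mul_le_mul (by linarith) hz6 (by positivity) (by positivity)
      _ = _ := by ring
  calc ‖-(lam / 2 * θ ^ 4 + sig / 3 * θ ^ 6 + Vt)‖ = ‖lam / 2 * θ ^ 4 + sig / 3 * θ ^ 6 + Vt‖ := norm_neg _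
    _ ≤ ‖lam / 2 * θ ^ 4 + sig / 3 * θ ^ 6‖ + ‖Vt‖ := norm_add_le _ _
    _ ≤ ‖lam / 2 * θ ^ 4‖ + ‖sig / 3 * θ ^ 6‖ + ‖Vt‖ := by linarith [norm_add_le (lam / 2 * θ ^ 4) (sig / 3 * θ ^ 6)]
    _ ≤ cl / 2 * (β * β ^ (-(4 * α))) + cs / 3 * (β * β ^ (-(4 * α))) + D * β ^ (-(2:ℝ)) := by linarith
    _ = (cl / 2 + cs / 3) * β ^ (1 - 4 * α) + D * β ^ (-(2:ℝ)) := by rw [hF]; ring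

/-- **(4.53) in modulus, upper**: `|h(θ)| ≤ exp{−βRe θ² + (½c_λ + ⅓c_σ)β^{1−4α} + Dβ^{−2}}` — the form in which the
siblings consume (4.53) (`MS87Eq517FirstLine`'s `h453`, `MS87NonperturbativeContributionL`'s `Dβ^{1−4α}`).
[cite: MullerSchiemann1987, (4.53) p.274; (A₃) p.267] -/
theorem eq453_norm_le {h V Vt lam sig θ : ℂ} {β α D cl cs : ℝ} (hβ : 1 ≤ β) (hα : 0 ≤ α)
    (hh : h = Complex.exp (-V)) (hV : V = β * θ ^ 2 + lam / 2 * θ ^ 4 + sig / 3 * θ ^ 6 + Vt)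
    (hVt : ‖Vt‖ ≤ D * β ^ (-(2:ℝ))) (hlam : ‖lam‖ ≤ cl * β) (hsig : ‖sig‖ ≤ cs * β) (hθ : ‖θ‖ ≤ β ^ (-α)) :
    ‖h‖ ≤ Real.exp (-(β * (θ ^ 2).re) + ((cl / 2 + cs / 3) * β ^ (1 - 4 * α) + D * β ^ (-(2:ℝ)))) := by
  obtain ⟨E, hE, hEn⟩ := eq453 hβ hα hh hV hVt hlam hsig hθ
  rw [hE, Complex.norm_exp, Complex.add_re, Complex.neg_re, Complex.re_ofReal_mul]
  exact Real.exp_le_exp.mpr (by linarith [Complex.re_le_norm E])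

/-- **(4.53) in modulus, lower**: `exp{−βRe θ² − (½c_λ + ⅓c_σ)β^{1−4α} − Dβ^{−2}} ≤ |h(θ)|`.
[cite: MullerSchiemann1987, (4.53) p.274; (A₃) p.267] -/
theorem eq453_norm_ge {h V Vt lam sig θ : ℂ} {β α D cl cs : ℝ} (hβ : 1 ≤ β) (hα : 0 ≤ α)
    (hh : h = Complex.exp (-V)) (hV : V = β * θ ^ 2 + lam / 2 * θ ^ 4 + sig / 3 * θ ^ 6 + Vt)
    (hVt : ‖Vt‖ ≤ D * β ^ (-(2:ℝ))) (hlam : ‖lam‖ ≤ cl * β) (hsig : ‖sig‖ ≤ cs * β) (hθ : ‖θ‖ ≤ β ^ (-α)) :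
    Real.exp (-(β * (θ ^ 2).re) - ((cl / 2 + cs / 3) * β ^ (1 - 4 * α) + D * β ^ (-(2:ℝ)))) ≤ ‖h‖ := by
  obtain ⟨E, hE, hEn⟩ := eq453 hβ hα hh hV hVt hlam hsig hθ
  rw [hE, Complex.norm_exp, Complex.add_re, Complex.neg_re, Complex.re_ofReal_mul]
  have := (abs_le.mp ((Complex.abs_re_le_norm E).trans hEn)).1
  exact Real.exp_le_exp.mpr (by linarith)

/-- `|θ| ≤ ϱ ⟺ |θ²| ≤ ϱ²` (`ϱ ≥ 0`): the small-field condition may be read on `θ²` (no branch of `θ` needed).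
[cite: MullerSchiemann1987, (2.18) p.265, p.276 L.20 («|θ²| < β^{−2α}»)] -/
theorem norm_le_iff_norm_sq_le {θ : ℂ} {ρ : ℝ} (hρ : 0 ≤ ρ) : ‖θ‖ ≤ ρ ↔ ‖θ ^ 2‖ ≤ ρ ^ 2 := by
  rw [norm_pow]
  exact (pow_le_pow_iff_left₀ (norm_nonneg θ) hρ two_ne_zero).symm

/-! ## §2 «|θ²| < β^{−2α} ⟹ 1 − w₀ = 𝒪(β^{−2α})» -/

/-- `|1 − C(Θ)| ≤ ½|Θ| + (5/96)|Θ|²` for `|Θ| ≤ 1`, where `C(θ²) = cos θ` (any square root `θ` of `Θ`, Mathlib's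
`|cos θ − (1 − θ²/2)| ≤ (5/96)|θ|⁴`). [cite: MullerSchiemann1987, Prop. 1 p.264] -/
theorem norm_one_sub_cosSq_le {Θ : ℂ} (hΘ : ‖Θ‖ ≤ 1) : ‖1 - cosSq Θ‖ ≤ ‖Θ‖ / 2 + 5 / 96 * ‖Θ‖ ^ 2 := by
  obtain ⟨θ, hθ⟩ := exists_sq_eq Θ
  have hn : ‖θ‖ ^ 2 = ‖Θ‖ := by rw [← norm_pow, hθ]
  have hθ1 : ‖θ‖ ≤ 1 := (norm_le_iff_norm_sq_le zero_le_one).mpr (by rw [hθ, one_pow]; exact hΘ)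
  have hb := Complex.cos_bound hθ1
  have hc : cosSq Θ = Complex.cos θ := by rw [cos_eq_cosSq, hθ]
  rw [hc]
  have e : (1 : ℂ) - Complex.cos θ = θ ^ 2 / 2 - (Complex.cos θ - (1 - θ ^ 2 / 2)) := by ring
  rw [e]
  have h4 : ‖θ‖ ^ 4 = ‖Θ‖ ^ 2 := by rw [← hn]; ring
  calc ‖θ ^ 2 / 2 - (Complex.cos θ - (1 - θ ^ 2 / 2))‖
        ≤ ‖θ ^ 2 / 2‖ + ‖Complex.cos θ - (1 - θ ^ 2 / 2)‖ := norm_sub_le _ _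
    _ ≤ ‖Θ‖ / 2 + 5 / 96 * ‖Θ‖ ^ 2 := by
        have h2 : ‖θ ^ 2 / 2‖ = ‖Θ‖ / 2 := by rw [norm_div, hθ, Complex.norm_ofNat]
        rw [h2]
        rw [h4] at hb
        linarith

/-- **`|η| ≤ ¼|θ²| + (5/192)|θ²|²`** for `|η(u, z)| < 1` and `|θ²(u, z)| ≤ 1`: Proposition 1's inversion
`C(θ²) = C(4f(η)) = 1 − 2η`, i.e. `η = ½(1 − C(θ²))` («η = sin²(θ/2)»). [cite: MullerSchiemann1987, Prop. 1 and (2.13) p.264] -/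
theorem norm_etaOf_le_of_thetaSq (U : Matrix.specialUnitaryGroup (Fin 2) ℂ) {z : ℂ} (hη : ‖etaOf U z‖ < 1)
    (hΘ : ‖thetaSq U z‖ ≤ 1) :
    ‖etaOf U z‖ ≤ ‖thetaSq U z‖ / 4 + 5 / 192 * ‖thetaSq U z‖ ^ 2 := by
  have h := cosSq_four_fC hη
  have hT : thetaSq U z = 4 * fC (etaOf U z) := rfl
  have e : etaOf U z = (1 - cosSq (thetaSq U z)) / 2 := by rw [hT, h]; ring
  have hb := norm_one_sub_cosSq_le hΘ
  rw [e, norm_div, Complex.norm_ofNat]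
  linarith

/-- **On the imaginary axis `1 − w₀ ≤ 2|η(w, it)| + (cosh t − 1)`** (`Re η(w, it) = ½(1 − w₀cosh t)`, `w₀ ≤ 1`).
[cite: MullerSchiemann1987, (2.13) p.264, (5.15)–(5.16) p.276] -/
theorem one_sub_u0_le (U : Matrix.specialUnitaryGroup (Fin 2) ℂ) (t : ℝ) :
    1 - u0 U ≤ 2 * ‖etaOf U ((t : ℂ) * I)‖ + (Real.cosh t - 1) := by
  have hre := etaOf_mul_I_re U t
  have h1 : (etaOf U ((t : ℂ) * I)).re ≤ ‖etaOf U ((t : ℂ) * I)‖ := Complex.re_le_norm _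
  have hu := abs_le.mp (abs_u0_le_one U)
  have hc : 0 ≤ Real.cosh t - 1 := by linarith [Real.one_le_cosh t]
  nlinarith [hu.1, hu.2, hc, h1, hre]

/-- **THE REGIME OF (5.15)/(5.16)/(4.60): `(1 − w₀) + t² ≤ (53/96)ϱ² + 2t²`** for `w₀ > −½`, `|t| < ¼` (so that
`|η(w, it)| < 1`, Proposition 1's printed domain), `|θ²(w, it)| ≤ ϱ² ≤ 1` — i.e. «|θ_j²| < β^{−2α} and |y| < ½κ(β′)^{−α}»
put `(1 − w₀) + t²` at order `β^{−2α}`, the hypothesis of the sibling `ThetaSqExpansion.re_thetaSq_mul_I`.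
[cite: MullerSchiemann1987, p.276 L.22–25 with (5.15)–(5.16); (4.60) p.275] -/
theorem s_le (U : Matrix.specialUnitaryGroup (Fin 2) ℂ) {t ρ : ℝ} (hU : -1 / 2 < u0 U) (ht : |t| < 1 / 4)
    (hΘ : ‖thetaSq U ((t : ℂ) * I)‖ ≤ ρ ^ 2) (hρ : ρ ^ 2 ≤ 1) :
    (1 - u0 U) + t ^ 2 ≤ 53 / 96 * ρ ^ 2 + 2 * t ^ 2 := by
  have hz : ‖(t : ℂ) * I‖ < 1 / 4 := by
    rw [norm_mul, Complex.norm_I, mul_one, Complex.norm_real, Real.norm_eq_abs]; exact ht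
  have hη1 := norm_etaOf_lt_one hz hU
  have hΘ1 : ‖thetaSq U ((t : ℂ) * I)‖ ≤ 1 := hΘ.trans hρ
  have hη := norm_etaOf_le_of_thetaSq U hη1 hΘ1
  have h1 := one_sub_u0_le U t
  have ht1 : |t| ≤ 1 := by linarith
  have hc := cosh_sub_one_le_sq ht1
  have h0 := norm_nonneg (thetaSq U ((t : ℂ) * I))
  have hsq : ‖thetaSq U ((t : ℂ) * I)‖ ^ 2 ≤ ρ ^ 2 := by nlinarith
  linarith

/-! ## §3 (4.60) ⟹ (4.61) -/

/-- **`Re θ²(w, it) ≥ −t² − 7A²ϱ⁴`, `A = 53/96 + κ²/2`**, in the regime `w₀ > −½`, `|t| < ¼`, `|θ²(w, it)| ≤ ϱ² ≤ 1`,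
`t² ≤ (κ/2)²ϱ²`, `Aϱ² ≤ ¼`: the sibling's (5.15)/(5.16) `Re θ² ≥ 2[1 − w₀] − t² − 7((1 − w₀) + t²)²` with §2
(«discarding the positive terms there», p.277). [cite: MullerSchiemann1987, (4.60) p.275, (5.15)–(5.16) p.276] -/
theorem re_thetaSq_ge (U : Matrix.specialUnitaryGroup (Fin 2) ℂ) {t ρ κ : ℝ} (hU : -1 / 2 < u0 U)
    (ht : |t| < 1 / 4) (hΘ : ‖thetaSq U ((t : ℂ) * I)‖ ≤ ρ ^ 2) (hρ : ρ ^ 2 ≤ 1)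
    (htκ : t ^ 2 ≤ (κ / 2) ^ 2 * ρ ^ 2) (hsmall : (53 / 96 + κ ^ 2 / 2) * ρ ^ 2 ≤ 1 / 4) :
    -t ^ 2 - 7 * ((53 / 96 + κ ^ 2 / 2) * ρ ^ 2) ^ 2 ≤ (thetaSq U ((t : ℂ) * I)).re := by
  have hs := s_le U hU ht hΘ hρ
  have hsA : (1 - u0 U) + t ^ 2 ≤ (53 / 96 + κ ^ 2 / 2) * ρ ^ 2 := by linarith
  have hs4 : (1 - u0 U) + t ^ 2 ≤ 1 / 4 := hsA.trans hsmall
  have hr := (abs_le.mp (re_thetaSq_mul_I U hs4)).1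
  have hu := abs_le.mp (abs_u0_le_one U)
  have hs0 : 0 ≤ (1 - u0 U) + t ^ 2 := by nlinarith
  have hsq : ((1 - u0 U) + t ^ 2) ^ 2 ≤ ((53 / 96 + κ ^ 2 / 2) * ρ ^ 2) ^ 2 := pow_le_pow_left₀ hs0 hsA 2
  linarith [hu.2]

/-- **(4.61): `|h(θ±)| < exp{β(y/2)² + 𝒪(β^{1−4α})}`, EXPLICIT** — with (4.53) in modulus form
`|F| ≤ exp{−βRe θ²(w, it) + E}` (`F = g̃(w, it) = h(θ)`, `E` the constant of `eq453_norm_le`), in the regime of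
`re_thetaSq_ge` at `ϱ = β^{−α}` (`β ≥ 1`, `α ≥ 0`): `|F| ≤ exp{βt² + 7A²β^{1−4α} + E}`, `A = 53/96 + κ²/2`; the print's
`t = y/2`. [cite: MullerSchiemann1987, (4.61) p.275; (4.53) p.274] -/
theorem eq461 (U : Matrix.specialUnitaryGroup (Fin 2) ℂ) {t κ β α E : ℝ} {F : ℂ} (hβ : 1 ≤ β) (hα : 0 ≤ α)
    (hU : -1 / 2 < u0 U) (ht : |t| < 1 / 4) (hΘ : ‖thetaSq U ((t : ℂ) * I)‖ ≤ (β ^ (-α)) ^ 2)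
    (htκ : t ^ 2 ≤ (κ / 2) ^ 2 * (β ^ (-α)) ^ 2) (hsmall : (53 / 96 + κ ^ 2 / 2) * (β ^ (-α)) ^ 2 ≤ 1 / 4)
    (hF : ‖F‖ ≤ Real.exp (-(β * (thetaSq U ((t : ℂ) * I)).re) + E)) :
    ‖F‖ ≤ Real.exp (β * t ^ 2 + 7 * (53 / 96 + κ ^ 2 / 2) ^ 2 * β ^ (1 - 4 * α) + E) := by
  have hβ0 : 0 < β := by linarith
  have hρ1 : (β ^ (-α)) ^ 2 ≤ 1 := by
    have h1 : β ^ (-α) ≤ 1 := Real.rpow_le_one_of_one_le_of_nonpos hβ (by linarith)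
    have h0 : 0 ≤ β ^ (-α) := Real.rpow_nonneg hβ0.le _
    nlinarith
  have hr := re_thetaSq_ge U hU ht hΘ hρ1 htκ hsmall
  refine hF.trans (Real.exp_le_exp.mpr ?_)
  have hF4 : β * β ^ (-(4 * α)) = β ^ (1 - 4 * α) := mul_rpow_neg hβ0
  have hm := mul_le_mul_of_nonneg_left hr hβ0.le
  have e : β * (-t ^ 2 - 7 * ((53 / 96 + κ ^ 2 / 2) * (β ^ (-α)) ^ 2) ^ 2) =
      -(β * t ^ 2) - 7 * (53 / 96 + κ ^ 2 / 2) ^ 2 * (β * (β ^ (-α)) ^ 4) := by ring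
  rw [e, rpow_neg_four hβ0, hF4] at hm
  linarith

/-! ## §4 (4.54) for `θ²` and `g̃`; (4.56) from (A₂) -/

/-- **(4.54) for `θ²`, general form**: `θ²(e^{−isσ₃}u, z′) = θ²(u, s + z′)` — from (2.17)
`(e^{−isσ₃}u)₀ = u₀cos s + u₃sin s`, `(e^{−isσ₃}u)₃ = u₃cos s − u₀sin s` and the addition theorems.
[cite: MullerSchiemann1987, (4.54) p.274, (2.17) p.265] -/
theorem thetaSq_diagPhase_mul (s : ℝ) (U : Matrix.specialUnitaryGroup (Fin 2) ℂ) (z : ℂ) :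
    thetaSq (diagPhase s * U) z = thetaSq U ((s : ℂ) + z) := by
  have hη : etaOf (diagPhase s * U) z = etaOf U ((s : ℂ) + z) := by
    simp only [CentralAngle.etaOf, u0_diagPhase_mul, u3_diagPhase_mul, Complex.cos_add, Complex.sin_add,
      ← Complex.ofReal_cos, ← Complex.ofReal_sin]
    push_cast
    ring
  simp only [CentralAngle.thetaSq, hη]

/-- **(4.54), `+`**: `θ²(v, z/2) = θ²(e^{−i(x/2)σ₃}v, iy/2)`, `z = x + iy`. [cite: MullerSchiemann1987, (4.54) p.274] -/
theorem eq454_plus (v : Matrix.specialUnitaryGroup (Fin 2) ℂ) (x y : ℝ) :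
    thetaSq v (((x : ℂ) + y * I) / 2) = thetaSq (diagPhase (x / 2) * v) (((y / 2 : ℝ) : ℂ) * I) := by
  rw [thetaSq_diagPhase_mul]; congr 1; push_cast; ring

/-- **(4.54), `−`**: `θ²(v, −z/2) = θ²(e^{+i(x/2)σ₃}v, −iy/2)`. [cite: MullerSchiemann1987, (4.54) p.274] -/
theorem eq454_minus (v : Matrix.specialUnitaryGroup (Fin 2) ℂ) (x y : ℝ) :
    thetaSq v (-(((x : ℂ) + y * I) / 2)) = thetaSq (diagPhase (-(x / 2)) * v) (((-(y / 2) : ℝ) : ℂ) * I) := by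
  rw [thetaSq_diagPhase_mul]; congr 1; push_cast; ring

/-- **(4.54) for `g̃`**: any `g̃` with the symmetry (2.8) `g̃(e^{−isσ₃}u, z′) = g̃(u, s + z′)` has
`g̃(v, ±z/2) = g̃(e^{∓i(x/2)σ₃}v, ±iy/2)`. [cite: MullerSchiemann1987, (4.54) p.274, (2.8) p.264] -/
theorem eq454_gt {gt : Matrix.specialUnitaryGroup (Fin 2) ℂ → ℂ → ℂ}
    (h28 : ∀ (s : ℝ) (U : Matrix.specialUnitaryGroup (Fin 2) ℂ) (z : ℂ), gt (diagPhase s * U) z = gt U ((s : ℂ) + z))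
    (v : Matrix.specialUnitaryGroup (Fin 2) ℂ) (x y : ℝ) :
    gt v (((x : ℂ) + y * I) / 2) = gt (diagPhase (x / 2) * v) (((y / 2 : ℝ) : ℂ) * I) ∧
      gt v (-(((x : ℂ) + y * I) / 2)) = gt (diagPhase (-(x / 2)) * v) (((-(y / 2) : ℝ) : ℂ) * I) := by
  refine ⟨?_, ?_⟩
  · rw [h28]; congr 1; push_cast; ring
  · rw [h28]; congr 1; push_cast; ring

/-- **(4.56) FROM (A₂)**: «Recalling |y/2| < ½(β′)^{−α} < (κ/2)β^{−α}, we can thus use in the supports of 1 − χ± the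
bound of assumption (A₂), which yields |g̃(v, ±z/2)| ≦ exp{−pβ^{1−2α} + β(y/2)²}» — for any `g̃` with (A₂) at scale `β`
(in the siblings' shape), `|y| < (β′)^{−α} ≤ κβ^{−α}` and `w ∉ 𝒢[i(y/2)·sign, β^{−α}]` (`w = e^{∓i(x/2)σ₃}v` by (4.54)).
[cite: MullerSchiemann1987, (4.56) p.274; (A₂) p.267] -/
theorem eq456 {gt : Matrix.specialUnitaryGroup (Fin 2) ℂ → ℂ → ℂ} {β β' α p κ : ℝ}
    (hA2 : ∀ y : ℝ, |y| < κ / 2 * β ^ (-α) → ∀ u : Matrix.specialUnitaryGroup (Fin 2) ℂ,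
      u ∉ regionG ((y : ℂ) * I) (β ^ (-α)) → ‖gt u ((y : ℂ) * I)‖ < Real.exp (β * y ^ 2 - p * β ^ (1 - 2 * α)))
    {y t : ℝ} (ht : t = y / 2 ∨ t = -(y / 2)) (hy : |y| < β' ^ (-α)) (hκ : β' ^ (-α) ≤ κ * β ^ (-α))
    {w : Matrix.specialUnitaryGroup (Fin 2) ℂ} (hw : w ∉ regionG ((t : ℂ) * I) (β ^ (-α))) :
    ‖gt w ((t : ℂ) * I)‖ < Real.exp (-p * β ^ (1 - 2 * α) + β * (y / 2) ^ 2) := by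
  have hta : |t| = |y| / 2 := by
    rcases ht with h | h
    · rw [h, abs_div, abs_two]
    · rw [h, abs_neg, abs_div, abs_two]
  have ht2 : t ^ 2 = (y / 2) ^ 2 := by
    rcases ht with h | h
    · rw [h]
    · rw [h]; ring
  have h1 : |t| < κ / 2 * β ^ (-α) := by rw [hta]; linarith
  have h2 := hA2 t h1 w hw
  rw [ht2] at h2
  rwa [show -p * β ^ (1 - 2 * α) + β * (y / 2) ^ 2 = β * (y / 2) ^ 2 - p * β ^ (1 - 2 * α) by ring]

/-! ## §5 (4.58): the support of `1 − χ(v)` -/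

/-- **(4.58): `w = 1 − v₀ ≥ ½ϱ′² − (5/96)ϱ′⁴` on the support of `1 − χ(v)`**, `χ(v) = χ(v; 0, ϱ′)`, `0 ≤ ϱ′ ≤ 1`: if
`v ∉ 𝒢[0, ϱ′]` then either `v₀ ≤ 0` (and `w ≥ 1`) or `θ(v)² = |θ²(v, 0)| ≥ ϱ′²` with the real central angle `θ(v) ∈ [0, π]`,
`cos θ(v) = v₀`, so `1 − v₀ ≥ 1 − cos ϱ′ ≥ ½ϱ′² − (5/96)ϱ′⁴`. [cite: MullerSchiemann1987, (4.58) p.274; (2.18)–(2.19) p.265] -/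
theorem eq458 (v : Matrix.specialUnitaryGroup (Fin 2) ℂ) {ρ' : ℝ} (hρ0 : 0 ≤ ρ') (hρ1 : ρ' ≤ 1)
    (hv : v ∉ regionG 0 ρ') : ρ' ^ 2 / 2 - 5 / 96 * ρ' ^ 4 ≤ 1 - u0 v := by
  have hu := abs_le.mp (abs_u0_le_one v)
  have hρ2 : ρ' ^ 2 ≤ 1 := by nlinarith
  have hρ4 : 0 ≤ ρ' ^ 4 := by positivity
  rcases le_or_gt (u0 v) 0 with h0 | h0
  · linarith
  have hΘ : ρ' ^ 2 ≤ ‖thetaSq v 0‖ := not_lt.mp fun hc => hv ⟨h0, hc⟩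
  have hT := thetaSq_ofReal v 0 (by rw [diagPhase_zero, one_mul]; linarith)
  rw [Complex.ofReal_zero, diagPhase_zero, one_mul] at hT
  have hθ0 : 0 ≤ centralAngle v := by rw [centralAngle_eq_arccos_u0]; exact Real.arccos_nonneg _
  have hθπ : centralAngle v ≤ Real.pi := by rw [centralAngle_eq_arccos_u0]; exact Real.arccos_le_pi _
  have hcos : Real.cos (centralAngle v) = u0 v := by rw [centralAngle_eq_arccos_u0]; exact Real.cos_arccos hu.1 hu.2
  have hn : ‖thetaSq v 0‖ = centralAngle v ^ 2 := by
    rw [hT, norm_pow, Complex.norm_real, Real.norm_eq_abs, sq_abs]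
  rw [hn] at hΘ
  have hle : ρ' ≤ centralAngle v := by nlinarith
  have hcm : Real.cos (centralAngle v) ≤ Real.cos ρ' := Real.cos_le_cos_of_nonneg_of_le_pi hρ0 hθπ hle
  have hb := Real.cos_bound (show |ρ'| ≤ 1 by rw [abs_of_nonneg hρ0]; exact hρ1)
  rw [abs_of_nonneg hρ0] at hb
  have := (abs_le.mp hb).2
  linarith

/-- **(4.58) at `ϱ′ = ξ′β^{−α}`**: `w ≥ ½(ξ′β^{−α})² − (5/96)ξ′⁴·β^{−4α}` — the sibling `MS87NonperturbativeContributionL`'s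
hypothesis `h458` with `D₂ = (5/96)ξ′⁴`. [cite: MullerSchiemann1987, (4.58) p.274] -/
theorem eq458_beta (v : Matrix.specialUnitaryGroup (Fin 2) ℂ) {ξ' β α : ℝ} (hβ : 0 < β) (hξ0 : 0 ≤ ξ')
    (hξ1 : ξ' * β ^ (-α) ≤ 1) (hv : v ∉ regionG 0 (ξ' * β ^ (-α))) :
    1 / 2 * (ξ' * β ^ (-α)) ^ 2 - 5 / 96 * ξ' ^ 4 * β ^ (-(4 * α)) ≤ 1 - u0 v := by
  have hρ0 : 0 ≤ ξ' * β ^ (-α) := mul_nonneg hξ0 (Real.rpow_nonneg hβ.le _)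
  have h := eq458 v hρ0 hξ1 hv
  rw [mul_pow ξ' (β ^ (-α)) 4, rpow_neg_four hβ] at h
  linarith

/-! ## §6 (4.57), real part, one-sided; the first line of (4.59) pointwise -/

/-- `1 − cos s ≥ ½s² − (5/96)s⁴` for `|s| ≤ 1`. [folklore] -/
private theorem one_sub_cos_ge {s : ℝ} (hs : |s| ≤ 1) : s ^ 2 / 2 - 5 / 96 * s ^ 4 ≤ 1 - Real.cos s := by
  have hb := Real.cos_bound hs
  have e4 : |s| ^ 4 = s ^ 4 := by
    rw [show (4:ℕ) = 2 * 2 from rfl, pow_mul, sq_abs, ← pow_mul]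
  rw [e4] at hb
  have := (abs_le.mp hb).2
  linarith

/-- **(4.57), REAL PART, AS A LOWER BOUND: `Re(θ₊² + θ₋²) ≥ 4w + ½(x² − y²) − D₃ϱ⁴`**, `θ±² = θ²(v, ±z/2)`, `w = 1 − v₀`,
`D₃ = 14A² + ½Aκ² + (5/384)κ⁴`, `A = 53/96 + κ²/2` — for `e^{∓i(x/2)σ₃}v ∈ 𝒢[±iy/2, ϱ]` (the support of `χ₊χ₋`, (4.55)),
`|y/2| < ¼`, `(y/2)² ≤ (κ/2)²ϱ²` and `x² ≤ κ²ϱ²` («|z| < (β′)^{−α}», `(β′)^{−α} < κβ^{−α}`), `ϱ² ≤ 1`, `Aϱ² ≤ ¼`. Route: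
(4.54), the sibling's (4.60)/(5.15)–(5.16) for both signs, `(e^{∓i(x/2)σ₃}v)₀ = v₀cos(x/2) ± v₃sin(x/2)` (2.17),
`1 − cos(x/2) ≥ x²/8 − (5/1536)x⁴`, and `w ≤ 1 − v₀cos(x/2) ≤ Aϱ²` (§2). («θ₊² + θ₋² = 4w + ½z² + 𝒪(β^{−4α})»;
`Re ½z² = ½(x² − y²)`.) [cite: MullerSchiemann1987, (4.57) p.274, (4.60) p.275, (4.12)–(4.13) p.270] -/
theorem eq457_re_ge (v : Matrix.specialUnitaryGroup (Fin 2) ℂ) {x y ρ κ : ℝ} (hy : |y / 2| < 1 / 4)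
    (hplus : diagPhase (x / 2) * v ∈ regionG (((y / 2 : ℝ) : ℂ) * I) ρ)
    (hminus : diagPhase (-(x / 2)) * v ∈ regionG (((-(y / 2) : ℝ) : ℂ) * I) ρ)
    (hρ : ρ ^ 2 ≤ 1) (hyκ : (y / 2) ^ 2 ≤ (κ / 2) ^ 2 * ρ ^ 2) (hxκ : x ^ 2 ≤ κ ^ 2 * ρ ^ 2)
    (hsmall : (53 / 96 + κ ^ 2 / 2) * ρ ^ 2 ≤ 1 / 4) :
    4 * (1 - u0 v) + (x ^ 2 - y ^ 2) / 2
        - (14 * (53 / 96 + κ ^ 2 / 2) ^ 2 + (53 / 96 + κ ^ 2 / 2) * κ ^ 2 / 2 + 5 / 384 * κ ^ 4) * ρ ^ 4 ≤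
      (thetaSq v (((x : ℂ) + y * I) / 2)).re + (thetaSq v (-(((x : ℂ) + y * I) / 2))).re := by
  rw [eq454_plus, eq454_minus]
  set wp := diagPhase (x / 2) * v with hwp
  set wm := diagPhase (-(x / 2)) * v with hwm
  obtain ⟨hp0, hpΘ⟩ := (mem_regionG.mp hplus)
  obtain ⟨hm0, hmΘ⟩ := (mem_regionG.mp hminus)
  have hρ0 : 0 ≤ ρ ^ 2 := sq_nonneg ρ
  have hym : |(-(y / 2))| < 1 / 4 := by rwa [abs_neg]
  -- §2 for both signs
  have hsp := s_le wp (by linarith) hy hpΘ.le hρ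
  have hsm := s_le wm (by linarith) hym hmΘ.le hρ
  have hspA : (1 - u0 wp) + (y / 2) ^ 2 ≤ (53 / 96 + κ ^ 2 / 2) * ρ ^ 2 := by linarith only [hsp, hyκ]
  have hsmA : (1 - u0 wm) + (-(y / 2)) ^ 2 ≤ (53 / 96 + κ ^ 2 / 2) * ρ ^ 2 := by linarith only [hsm, hyκ]
  have hsp4 : (1 - u0 wp) + (y / 2) ^ 2 ≤ 1 / 4 := hspA.trans hsmall
  have hsm4 : (1 - u0 wm) + (-(y / 2)) ^ 2 ≤ 1 / 4 := hsmA.trans hsmall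
  -- the sibling's (4.60)/(5.15)–(5.16) for both signs
  have hrp := (abs_le.mp (re_thetaSq_mul_I wp hsp4)).1
  have hrm := (abs_le.mp (re_thetaSq_mul_I wm hsm4)).1
  have hup := abs_le.mp (abs_u0_le_one wp)
  have hum := abs_le.mp (abs_u0_le_one wm)
  have hsp0 : 0 ≤ (1 - u0 wp) + (y / 2) ^ 2 := add_nonneg (by linarith only [hup.2]) (sq_nonneg _)
  have hsm0 : 0 ≤ (1 - u0 wm) + (-(y / 2)) ^ 2 := add_nonneg (by linarith only [hum.2]) (sq_nonneg _)
  have hA0 : 0 ≤ (53 / 96 + κ ^ 2 / 2) * ρ ^ 2 := hsp0.trans hspA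
  have hsqp : ((1 - u0 wp) + (y / 2) ^ 2) ^ 2 ≤ ((53 / 96 + κ ^ 2 / 2) * ρ ^ 2) ^ 2 :=
    pow_le_pow_left₀ hsp0 hspA 2
  have hsqm : ((1 - u0 wm) + (-(y / 2)) ^ 2) ^ 2 ≤ ((53 / 96 + κ ^ 2 / 2) * ρ ^ 2) ^ 2 :=
    pow_le_pow_left₀ hsm0 hsmA 2
  -- (2.17): (e^{∓i(x/2)σ₃}v)₀ = v₀cos(x/2) ± v₃sin(x/2)
  have hwp0 : u0 wp = u0 v * Real.cos (x / 2) + u3 v * Real.sin (x / 2) := by rw [hwp, u0_diagPhase_mul]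
  have hwm0 : u0 wm = u0 v * Real.cos (x / 2) - u3 v * Real.sin (x / 2) := by
    rw [hwm, u0_diagPhase_mul, Real.cos_neg, Real.sin_neg]; ring
  -- |x/2| ≤ 1, cos(x/2) > 0, v₀ > 0
  have hx2 : (x / 2) ^ 2 ≤ 1 / 8 := by linarith only [hxκ, hsmall, hρ0]
  have hxa : |x / 2| ≤ 1 := (sq_le_one_iff_abs_le_one (x / 2)).mp (by linarith)
  have hcpos : 0 < Real.cos (x / 2) := by
    have h1 := abs_le.mp hxa
    have h3 := Real.pi_gt_three
    exact Real.cos_pos_of_mem_Ioo (Set.mem_Ioo.mpr ⟨by linarith only [h1.1, h3], by linarith only [h1.2, h3]⟩)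
  have hc1 : Real.cos (x / 2) ≤ 1 := Real.cos_le_one _
  have hv0 : 0 < u0 v := by
    rcases le_or_gt (u0 v) 0 with hc | hc
    · have : u0 v * Real.cos (x / 2) ≤ 0 := mul_nonpos_iff.mpr (Or.inr ⟨hc, hcpos.le⟩)
      linarith only [this, hp0, hm0, hwp0, hwm0]
    · exact hc
  have hu := abs_le.mp (abs_u0_le_one v)
  -- w ≤ 1 − v₀cos(x/2) ≤ Aϱ²
  have hvc : u0 v * Real.cos (x / 2) ≤ u0 v := mul_le_of_le_one_right hv0.le hc1
  have hw : 1 - u0 v ≤ (53 / 96 + κ ^ 2 / 2) * ρ ^ 2 := by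
    linarith only [hvc, hspA, hsmA, hwp0, hwm0, sq_nonneg (y / 2)]
  have hw0 : 0 ≤ 1 - u0 v := by linarith only [hu.2]
  -- 1 − cos(x/2) ≥ x²/8 − (5/1536)x⁴, times v₀ ≥ 0
  have hcb : x ^ 2 / 8 - 5 / 1536 * x ^ 4 ≤ 1 - Real.cos (x / 2) := by
    have h1 := one_sub_cos_ge hxa
    have e1 : (x / 2) ^ 2 / 2 - 5 / 96 * (x / 2) ^ 4 = x ^ 2 / 8 - 5 / 1536 * x ^ 4 := by ring
    linarith only [h1, e1]
  have p3 := mul_le_mul_of_nonneg_left hcb hv0.le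
  -- products: w·x² ≤ Aϱ²·κ²ϱ², v₀x⁴ ≤ κ⁴ϱ⁴
  have p1 : (1 - u0 v) * x ^ 2 ≤ (53 / 96 + κ ^ 2 / 2) * ρ ^ 2 * (κ ^ 2 * ρ ^ 2) :=
    mul_le_mul hw hxκ (sq_nonneg x) hA0
  have hx4 : x ^ 4 ≤ (κ ^ 2 * ρ ^ 2) ^ 2 := by
    have := pow_le_pow_left₀ (sq_nonneg x) hxκ 2
    rwa [← pow_mul] at this
  have p2 : u0 v * x ^ 4 ≤ 1 * (κ ^ 2 * ρ ^ 2) ^ 2 := mul_le_mul hu.2 hx4 (by positivity) zero_le_one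
  linarith only [p1, p2, p3, hrp, hrm, hsqp, hsqm, hwp0, hwm0]

/-- **(4.57) at `ϱ = β^{−α}`**: `Re(θ₊² + θ₋²) ≥ 4w + ½(x² − y²) − D₃β^{−4α}` — the sibling
`MS87NonperturbativeContributionL`'s hypothesis `h457` (`R = Re(θ₊² + θ₋²)`). [cite: MullerSchiemann1987, (4.57) p.274] -/
theorem eq457_beta (v : Matrix.specialUnitaryGroup (Fin 2) ℂ) {x y β α κ : ℝ} (hβ : 1 ≤ β) (hα : 0 ≤ α)
    (hy : |y / 2| < 1 / 4)
    (hplus : diagPhase (x / 2) * v ∈ regionG (((y / 2 : ℝ) : ℂ) * I) (β ^ (-α)))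
    (hminus : diagPhase (-(x / 2)) * v ∈ regionG (((-(y / 2) : ℝ) : ℂ) * I) (β ^ (-α)))
    (hyκ : (y / 2) ^ 2 ≤ (κ / 2) ^ 2 * (β ^ (-α)) ^ 2) (hxκ : x ^ 2 ≤ κ ^ 2 * (β ^ (-α)) ^ 2)
    (hsmall : (53 / 96 + κ ^ 2 / 2) * (β ^ (-α)) ^ 2 ≤ 1 / 4) :
    4 * (1 - u0 v) + (x ^ 2 - y ^ 2) / 2
        - (14 * (53 / 96 + κ ^ 2 / 2) ^ 2 + (53 / 96 + κ ^ 2 / 2) * κ ^ 2 / 2 + 5 / 384 * κ ^ 4) * β ^ (-(4 * α)) ≤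
      (thetaSq v (((x : ℂ) + y * I) / 2)).re + (thetaSq v (-(((x : ℂ) + y * I) / 2))).re := by
  have hβ0 : 0 < β := by linarith
  have hρ1 : (β ^ (-α)) ^ 2 ≤ 1 := by
    have h1 : β ^ (-α) ≤ 1 := Real.rpow_le_one_of_one_le_of_nonpos hβ (by linarith)
    have h0 : 0 ≤ β ^ (-α) := Real.rpow_nonneg hβ0.le _
    nlinarith
  have h := eq457_re_ge v hy hplus hminus hρ1 hyκ hxκ hsmall
  rwa [rpow_neg_four hβ0] at h

/-- **THE FIRST LINE OF (4.59), POINTWISE**: «|I⁽¹⁾| ≦ ∫dv[1 − χ(v)]χ₊χ₋ exp{−4βw − (β/2)(x² − y²) + 𝒪(β^{1−4α})}» — on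
the support of `χ₊χ₋`, with both factors bounded by (4.53) in modulus form (`|h(θ±)| ≤ exp{−βRe θ±² + E}`) and (4.57):
`|h(θ₊)h(θ₋)| ≤ exp{−4βw − (β/2)(x² − y²) + D₃β^{1−4α} + 2E}`. [cite: MullerSchiemann1987, (4.59) p.274] -/
theorem eq459_pointwise (v : Matrix.specialUnitaryGroup (Fin 2) ℂ) {x y β α κ E : ℝ} {F₁ F₂ : ℂ} (hβ : 1 ≤ β)
    (hα : 0 ≤ α) (hy : |y / 2| < 1 / 4)
    (hplus : diagPhase (x / 2) * v ∈ regionG (((y / 2 : ℝ) : ℂ) * I) (β ^ (-α)))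
    (hminus : diagPhase (-(x / 2)) * v ∈ regionG (((-(y / 2) : ℝ) : ℂ) * I) (β ^ (-α)))
    (hyκ : (y / 2) ^ 2 ≤ (κ / 2) ^ 2 * (β ^ (-α)) ^ 2) (hxκ : x ^ 2 ≤ κ ^ 2 * (β ^ (-α)) ^ 2)
    (hsmall : (53 / 96 + κ ^ 2 / 2) * (β ^ (-α)) ^ 2 ≤ 1 / 4)
    (h1 : ‖F₁‖ ≤ Real.exp (-(β * (thetaSq v (((x : ℂ) + y * I) / 2)).re) + E))
    (h2 : ‖F₂‖ ≤ Real.exp (-(β * (thetaSq v (-(((x : ℂ) + y * I) / 2))).re) + E)) :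
    ‖F₁ * F₂‖ ≤ Real.exp (-(4 * β * (1 - u0 v)) - β / 2 * (x ^ 2 - y ^ 2) +
      ((14 * (53 / 96 + κ ^ 2 / 2) ^ 2 + (53 / 96 + κ ^ 2 / 2) * κ ^ 2 / 2 + 5 / 384 * κ ^ 4) * β ^ (1 - 4 * α)
        + 2 * E)) := by
  have hβ0 : 0 < β := by linarith
  have h457 := eq457_beta v hβ hα hy hplus hminus hyκ hxκ hsmall
  have hm := mul_le_mul_of_nonneg_left h457 hβ0.le
  have hF4 : β * β ^ (-(4 * α)) = β ^ (1 - 4 * α) := mul_rpow_neg hβ0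
  rw [norm_mul]
  calc ‖F₁‖ * ‖F₂‖ ≤ Real.exp (-(β * (thetaSq v (((x : ℂ) + y * I) / 2)).re) + E) *
        Real.exp (-(β * (thetaSq v (-(((x : ℂ) + y * I) / 2))).re) + E) :=
        mul_le_mul h1 h2 (norm_nonneg _) (Real.exp_pos _).le
    _ = Real.exp ((-(β * (thetaSq v (((x : ℂ) + y * I) / 2)).re) + E) +
        (-(β * (thetaSq v (-(((x : ℂ) + y * I) / 2))).re) + E)) := (Real.exp_add _ _).symm
    _ ≤ _ := Real.exp_le_exp.mpr (by
        have e : β * (4 * (1 - u0 v) + (x ^ 2 - y ^ 2) / 2 -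
            (14 * (53 / 96 + κ ^ 2 / 2) ^ 2 + (53 / 96 + κ ^ 2 / 2) * κ ^ 2 / 2 + 5 / 384 * κ ^ 4) *
              β ^ (-(4 * α))) =
            4 * β * (1 - u0 v) + β / 2 * (x ^ 2 - y ^ 2) -
              (14 * (53 / 96 + κ ^ 2 / 2) ^ 2 + (53 / 96 + κ ^ 2 / 2) * κ ^ 2 / 2 + 5 / 384 * κ ^ 4) *
                (β * β ^ (-(4 * α))) := by ring
        rw [e, hF4] at hm
        nlinarith [hm])

/-! ## §7 (v1.1) (4.7): the small-field domain in which `K(z)` is analysed -/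

/-- For `|ζ| ≤ 1`: `|1 − cos ζ| ≤ ½|ζ|² + (5/96)|ζ|⁴`, `|cos ζ| ≤ 1 + |ζ|²`, `|sin ζ| ≤ |ζ| + ¼|ζ|³` (Mathlib's Taylor
bounds for the complex `cos`, `sin`). [folklore] -/
private theorem trig_bounds {ζ : ℂ} (h : ‖ζ‖ ≤ 1) :
    ‖1 - Complex.cos ζ‖ ≤ ‖ζ‖ ^ 2 / 2 + 5 / 96 * ‖ζ‖ ^ 4 ∧ ‖Complex.cos ζ‖ ≤ 1 + ‖ζ‖ ^ 2 ∧
      ‖Complex.sin ζ‖ ≤ ‖ζ‖ + ‖ζ‖ ^ 3 / 4 := by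
  have hc := Complex.cos_bound h
  have hs := Complex.sin_bound h
  have a0 := norm_nonneg ζ
  have h2 : ‖ζ ^ 2 / 2‖ = ‖ζ‖ ^ 2 / 2 := by rw [norm_div, norm_pow, Complex.norm_ofNat]
  have h3 : ‖ζ - ζ ^ 3 / 6‖ ≤ ‖ζ‖ + ‖ζ‖ ^ 3 / 6 := by
    refine (norm_sub_le _ _).trans ?_
    rw [norm_div, norm_pow, Complex.norm_ofNat]
  have a2 : ‖ζ‖ ^ 2 ≤ 1 := pow_le_one₀ a0 h
  have a4 : ‖ζ‖ ^ 4 ≤ ‖ζ‖ ^ 2 := by nlinarith [pow_nonneg a0 2]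
  have a53 : ‖ζ‖ ^ 5 ≤ ‖ζ‖ ^ 3 := by nlinarith [pow_nonneg a0 3]
  refine ⟨?_, ?_, ?_⟩
  · have e : (1 : ℂ) - Complex.cos ζ = ζ ^ 2 / 2 - (Complex.cos ζ - (1 - ζ ^ 2 / 2)) := by ring
    rw [e]
    exact (norm_sub_le _ _).trans (by rw [h2]; linarith)
  · have e : Complex.cos ζ = (1 - ζ ^ 2 / 2) + (Complex.cos ζ - (1 - ζ ^ 2 / 2)) := by ring
    rw [e]
    refine (norm_add_le _ _).trans ?_
    have : ‖(1 : ℂ) - ζ ^ 2 / 2‖ ≤ 1 + ‖ζ‖ ^ 2 / 2 := (norm_sub_le _ _).trans (by rw [norm_one, h2])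
    linarith [pow_nonneg a0 2]
  · have e : Complex.sin ζ = (ζ - ζ ^ 3 / 6) + (Complex.sin ζ - (ζ - ζ ^ 3 / 6)) := by ring
    rw [e]
    refine (norm_add_le _ _).trans ?_
    linarith [pow_nonneg a0 3]

/-- **(4.7): `|θ²(v, ±z/2)| < β^{−2α}` on the support of `χ(v)` in the extended domain (4.6)** — «For β sufficiently
large, (4.1), (4.6) and χ(v) = 1 imply with (2.13), |θ²(v, ±z/2)| < β^{−2α}. (4.7) Thus we can use the assumption (A₃)
together with Proposition 1»: for `v ∈ 𝒢[0, ξ′ϱ]` (`χ(v) = 1`, (4.2)), `|ζ| ≤ (1 − ξ)ϱ` (`ζ = ±z/2`, `|z| < 2(1 − ξ)β^{−α}`,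
(4.6)), `0 ≤ ξ′ < ξ ≤ 1` ((4.1): `0 < ξ′ < ξ ≤ ¼`) and `ϱ = β^{−α}` with `ϱ ≤ ½`, `4ϱ² ≤ ξ − ξ′` («β sufficiently large»):
`|θ²(v, ζ)| < ϱ²`. Route (a triangle inequality for the complexified central angle): with `t = θ(v) < ξ′ϱ` the real
central angle (`cos t = v₀`, `|v₃| ≤ sin t ≤ t`), `2η(v, ζ) = (1 − cos ζ) + (1 − v₀)cos ζ − v₃ sin ζ` gives
`|η| ≤ ¼(t + |ζ|)² + ½(t + |ζ|)⁴`, and `|θ²| = 4|f(η)| ≤ 4|η| + 8|η|²` (the sibling's `|f(η) − η| ≤ 2|η|²`), so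
`|θ²| ≤ S²(1 + 4S²)`, `S = t + |ζ| < (1 − (ξ − ξ′))ϱ`. [cite: MullerSchiemann1987, (4.6)–(4.7) p.269, (4.1)–(4.2) p.269] -/
theorem eq47 (v : Matrix.specialUnitaryGroup (Fin 2) ℂ) {ξ ξ' ρ : ℝ} {ζ : ℂ} (hρ0 : 0 < ρ) (hρ1 : ρ ≤ 1 / 2)
    (hξ'0 : 0 ≤ ξ') (hξ : ξ' < ξ) (hξ1 : ξ ≤ 1) (hlarge : 4 * ρ ^ 2 ≤ ξ - ξ')
    (hv : v ∈ regionG 0 (ξ' * ρ)) (hζ : ‖ζ‖ ≤ (1 - ξ) * ρ) :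
    ‖thetaSq v ζ‖ < ρ ^ 2 := by
  obtain ⟨hv0, hvΘ⟩ := mem_regionG.mp hv
  have hu := abs_le.mp (abs_u0_le_one v)
  -- the real central angle `t = θ(v)`: `cos t = v₀`, `0 ≤ t ≤ π`, `θ²(v, 0) = t²`, hence `t < ξ′ϱ`
  have hT := thetaSq_ofReal v 0 (by rw [diagPhase_zero, one_mul]; linarith)
  rw [Complex.ofReal_zero, diagPhase_zero, one_mul] at hT
  set t := centralAngle v with ht_def
  have ht0 : 0 ≤ t := by rw [ht_def, centralAngle_eq_arccos_u0]; exact Real.arccos_nonneg _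
  have htπ : t ≤ Real.pi := by rw [ht_def, centralAngle_eq_arccos_u0]; exact Real.arccos_le_pi _
  have hcos : Real.cos t = u0 v := by
    rw [ht_def, centralAngle_eq_arccos_u0]; exact Real.cos_arccos hu.1 hu.2
  have hn : ‖thetaSq v 0‖ = t ^ 2 := by rw [hT, norm_pow, Complex.norm_real, Real.norm_eq_abs, sq_abs]
  rw [hn] at hvΘ
  have hξρ : 0 ≤ ξ' * ρ := mul_nonneg hξ'0 hρ0.le
  have htlt : t < ξ' * ρ := lt_of_pow_lt_pow_left₀ 2 hξρ hvΘ
  -- `1 − v₀ ≤ t²/2`, `|v₃| ≤ t`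
  have h1v0 : 1 - u0 v ≤ t ^ 2 / 2 := by have := Real.one_sub_sq_div_two_le_cos (x := t); linarith
  have h1v0' : 0 ≤ 1 - u0 v := by linarith
  have hsin0 : 0 ≤ Real.sin t := Real.sin_nonneg_of_nonneg_of_le_pi ht0 htπ
  have hsint : Real.sin t ≤ t := Real.sin_le ht0
  have hv3sq : u3 v ^ 2 ≤ t ^ 2 := by
    have h1 := u0_sq_add_u3_sq_le_one v
    have h2 := Real.sin_sq_add_cos_sq t
    rw [hcos] at h2
    have h3 : Real.sin t ^ 2 ≤ t ^ 2 := pow_le_pow_left₀ hsin0 hsint 2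
    linarith
  have hv3 : |u3 v| ≤ t := abs_le_of_sq_le_sq hv3sq ht0
  -- `|ζ| ≤ (1 − ξ)ϱ ≤ 1`
  have ha0 := norm_nonneg ζ
  have hξρ' : 0 ≤ ξ * ρ := mul_nonneg (by linarith) hρ0.le
  have hδρ : 0 ≤ (ξ - ξ') * ρ := mul_nonneg (by linarith) hρ0.le
  have ha1 : ‖ζ‖ ≤ 1 := by linarith
  obtain ⟨hc1, hc2, hs1⟩ := trig_bounds ha1
  -- `S = t + |ζ| < (1 − (ξ − ξ′))ϱ ≤ ½`
  have hS0 : 0 ≤ t + ‖ζ‖ := add_nonneg ht0 ha0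
  have hS : t + ‖ζ‖ < (1 - (ξ - ξ')) * ρ := by linarith
  have hS1 : t + ‖ζ‖ ≤ 1 / 2 := by linarith
  -- `|2η| ≤ ½|ζ|² + (5/96)|ζ|⁴ + ½t²(1 + |ζ|²) + t(|ζ| + ¼|ζ|³)`
  have e2 : 2 * etaOf v ζ =
      (1 - Complex.cos ζ) + ((1 - u0 v : ℝ) : ℂ) * Complex.cos ζ - (u3 v : ℂ) * Complex.sin ζ := by
    simp only [CentralAngle.etaOf]; push_cast; ring
  have hη2 : ‖2 * etaOf v ζ‖ ≤ (‖ζ‖ ^ 2 / 2 + 5 / 96 * ‖ζ‖ ^ 4) + t ^ 2 / 2 * (1 + ‖ζ‖ ^ 2) +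
      t * (‖ζ‖ + ‖ζ‖ ^ 3 / 4) := by
    rw [e2]
    refine (norm_sub_le _ _).trans ?_
    refine (add_le_add (norm_add_le _ _) le_rfl).trans ?_
    rw [norm_mul, norm_mul, Complex.norm_real, Complex.norm_real, Real.norm_eq_abs, Real.norm_eq_abs,
      abs_of_nonneg h1v0']
    have m2 : (1 - u0 v) * ‖Complex.cos ζ‖ ≤ t ^ 2 / 2 * (1 + ‖ζ‖ ^ 2) :=
      mul_le_mul h1v0 hc2 (norm_nonneg _) (by positivity)
    have m3 : |u3 v| * ‖Complex.sin ζ‖ ≤ t * (‖ζ‖ + ‖ζ‖ ^ 3 / 4) := mul_le_mul hv3 hs1 (norm_nonneg _) ht0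
    linarith
  -- `|η| ≤ ¼S² + ½S⁴`
  have hηn : ‖etaOf v ζ‖ ≤ (t + ‖ζ‖) ^ 2 / 4 + (t + ‖ζ‖) ^ 4 / 2 := by
    have h2n : ‖2 * etaOf v ζ‖ = 2 * ‖etaOf v ζ‖ := by rw [norm_mul, Complex.norm_ofNat]
    have ta : t ≤ t + ‖ζ‖ := by linarith
    have aS : ‖ζ‖ ≤ t + ‖ζ‖ := by linarith
    have p4 : ‖ζ‖ ^ 4 ≤ (t + ‖ζ‖) ^ 4 := pow_le_pow_left₀ ha0 aS 4
    have p22 : t ^ 2 * ‖ζ‖ ^ 2 ≤ (t + ‖ζ‖) ^ 2 * (t + ‖ζ‖) ^ 2 :=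
      mul_le_mul (pow_le_pow_left₀ ht0 ta 2) (pow_le_pow_left₀ ha0 aS 2) (by positivity) (by positivity)
    have p13 : t * ‖ζ‖ ^ 3 ≤ (t + ‖ζ‖) * (t + ‖ζ‖) ^ 3 :=
      mul_le_mul ta (pow_le_pow_left₀ ha0 aS 3) (by positivity) hS0
    rw [h2n] at hη2
    linarith only [hη2, p4, p22, p13, pow_nonneg hS0 4]
  have hS2 : (t + ‖ζ‖) ^ 2 ≤ 1 / 4 := by
    have := pow_le_pow_left₀ hS0 hS1 2
    linarith only [this]
  have hS4 : (t + ‖ζ‖) ^ 4 ≤ 1 / 16 := by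
    have := pow_le_pow_left₀ hS0 hS1 4
    linarith only [this]
  have m0 := norm_nonneg (etaOf v ζ)
  have hη_half : ‖etaOf v ζ‖ ≤ 1 / 2 := by linarith only [hηn, hS2, hS4]
  -- `|θ²| = 4|f(η)| ≤ 4|η| + 8|η|² ≤ S² + 4S⁴`
  have hf := ThetaSqExpansion.norm_fC_sub_self_le hη_half
  have hΘ : ‖thetaSq v ζ‖ ≤ 4 * ‖etaOf v ζ‖ + 8 * ‖etaOf v ζ‖ ^ 2 := by
    have e : thetaSq v ζ = 4 * ((fC (etaOf v ζ) - etaOf v ζ) + etaOf v ζ) := by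
      simp only [CentralAngle.thetaSq]; ring
    rw [e, norm_mul, Complex.norm_ofNat]
    have := norm_add_le (fC (etaOf v ζ) - etaOf v ζ) (etaOf v ζ)
    linarith only [this, hf]
  have hM : 4 * ‖etaOf v ζ‖ + 8 * ‖etaOf v ζ‖ ^ 2 ≤ (t + ‖ζ‖) ^ 2 + 4 * (t + ‖ζ‖) ^ 4 := by
    have hsq : ‖etaOf v ζ‖ ^ 2 ≤ ((t + ‖ζ‖) ^ 2 / 4 + (t + ‖ζ‖) ^ 4 / 2) ^ 2 := pow_le_pow_left₀ m0 hηn 2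
    have h4 := pow_nonneg hS0 4
    have hS6 : (t + ‖ζ‖) ^ 6 ≤ (t + ‖ζ‖) ^ 4 / 4 := by
      have e : (t + ‖ζ‖) ^ 6 = (t + ‖ζ‖) ^ 4 * (t + ‖ζ‖) ^ 2 := by ring
      rw [e]
      have := mul_le_mul_of_nonneg_left hS2 h4
      linarith only [this]
    have hS8 : (t + ‖ζ‖) ^ 8 ≤ (t + ‖ζ‖) ^ 4 / 16 := by
      have e : (t + ‖ζ‖) ^ 8 = (t + ‖ζ‖) ^ 4 * (t + ‖ζ‖) ^ 4 := by ring
      rw [e]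
      have := mul_le_mul_of_nonneg_left hS4 h4
      linarith only [this]
    linarith only [hsq, hηn, hS6, hS8, m0, h4]
  -- `S < R := (1 − (ξ − ξ′))ϱ`, and `R²(1 + 4R²) ≤ ϱ²` because `4ϱ² ≤ ξ − ξ′`
  have hR0 : 0 ≤ (1 - (ξ - ξ')) * ρ := hS0.trans hS.le
  have hSR2 : (t + ‖ζ‖) ^ 2 < ((1 - (ξ - ξ')) * ρ) ^ 2 := pow_lt_pow_left₀ hS hS0 two_ne_zero
  have hSR4 : (t + ‖ζ‖) ^ 4 ≤ ((1 - (ξ - ξ')) * ρ) ^ 4 := pow_le_pow_left₀ hS0 hS.le 4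
  have hRρ : ((1 - (ξ - ξ')) * ρ) ^ 2 * (1 + 4 * ((1 - (ξ - ξ')) * ρ) ^ 2) ≤ ρ ^ 2 := by
    have hρ2 := sq_nonneg ρ
    have hδ0 : 0 ≤ 1 - (ξ - ξ') := by linarith
    have hδ1 : (1 - (ξ - ξ')) ^ 2 ≤ 1 - (ξ - ξ') := by
      rw [sq]; exact mul_le_of_le_one_left hδ0 (by linarith)
    have hb : 0 ≤ (1 - (ξ - ξ')) * ρ ^ 2 := mul_nonneg hδ0 hρ2
    have hR2 : ((1 - (ξ - ξ')) * ρ) ^ 2 ≤ (1 - (ξ - ξ')) * ρ ^ 2 := by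
      calc ((1 - (ξ - ξ')) * ρ) ^ 2 = (1 - (ξ - ξ')) ^ 2 * ρ ^ 2 := by ring
        _ ≤ (1 - (ξ - ξ')) * ρ ^ 2 := mul_le_mul_of_nonneg_right hδ1 hρ2
    have hδρ2 : 0 ≤ (ξ - ξ') * ρ ^ 2 := mul_nonneg (by linarith) hρ2
    have hR2' : ((1 - (ξ - ξ')) * ρ) ^ 2 ≤ ρ ^ 2 := by linarith only [hR2, hδρ2]
    have k1 : ((1 - (ξ - ξ')) * ρ) ^ 2 * (1 + 4 * ((1 - (ξ - ξ')) * ρ) ^ 2) ≤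
        (1 - (ξ - ξ')) * ρ ^ 2 * (1 + 4 * ρ ^ 2) :=
      mul_le_mul hR2 (by linarith only [hR2']) (by positivity) hb
    have k2 : (1 - (ξ - ξ')) * ρ ^ 2 * (1 + 4 * ρ ^ 2) ≤ (1 - (ξ - ξ')) * ρ ^ 2 * (1 + (ξ - ξ')) :=
      mul_le_mul_of_nonneg_left (by linarith only [hlarge]) hb
    have k3 : (1 - (ξ - ξ')) * ρ ^ 2 * (1 + (ξ - ξ')) = ρ ^ 2 - (ξ - ξ') ^ 2 * ρ ^ 2 := by ring
    have k4 : 0 ≤ (ξ - ξ') ^ 2 * ρ ^ 2 := mul_nonneg (sq_nonneg _) hρ2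
    linarith only [k1, k2, k3, k4]
  calc ‖thetaSq v ζ‖ ≤ 4 * ‖etaOf v ζ‖ + 8 * ‖etaOf v ζ‖ ^ 2 := hΘ
    _ ≤ (t + ‖ζ‖) ^ 2 + 4 * (t + ‖ζ‖) ^ 4 := hM
    _ < ((1 - (ξ - ξ')) * ρ) ^ 2 + 4 * ((1 - (ξ - ξ')) * ρ) ^ 4 := by linarith only [hSR2, hSR4]
    _ = ((1 - (ξ - ξ')) * ρ) ^ 2 * (1 + 4 * ((1 - (ξ - ξ')) * ρ) ^ 2) := by ring
    _ ≤ ρ ^ 2 := hRρ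

/-- **(4.7) as printed, at `ϱ = β^{−α}`**: `χ(v) = 1` (i.e. `v ∈ 𝒢[0, ξ′β^{−α}]`) and `|z| < 2(1 − ξ)β^{−α}` give
`|θ²(v, ±z/2)| < β^{−2α}`, for `β` large (`β^{−α} ≤ ½`, `4β^{−2α} ≤ ξ − ξ′`). [cite: MullerSchiemann1987, (4.7) p.269] -/
theorem eq47_beta (v : Matrix.specialUnitaryGroup (Fin 2) ℂ) {ξ ξ' β α : ℝ} {z : ℂ} (hβ : 0 < β)
    (hρ1 : β ^ (-α) ≤ 1 / 2) (hξ'0 : 0 ≤ ξ') (hξ : ξ' < ξ) (hξ1 : ξ ≤ 1)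
    (hlarge : 4 * β ^ (-(2 * α)) ≤ ξ - ξ') (hv : v ∈ regionG 0 (ξ' * β ^ (-α)))
    (hz : ‖z‖ < 2 * (1 - ξ) * β ^ (-α)) :
    ‖thetaSq v (z / 2)‖ < β ^ (-(2 * α)) ∧ ‖thetaSq v (-(z / 2))‖ < β ^ (-(2 * α)) := by
  have hρ0 : 0 < β ^ (-α) := Real.rpow_pos_of_pos hβ _
  have h2 : (β ^ (-α)) ^ 2 = β ^ (-(2 * α)) := by
    rw [← Real.rpow_natCast, ← Real.rpow_mul hβ.le]; ring_nf
  rw [← h2] at hlarge ⊢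
  have hζ : ‖z / 2‖ ≤ (1 - ξ) * β ^ (-α) := by
    rw [norm_div, Complex.norm_ofNat]; linarith
  have hζ' : ‖-(z / 2)‖ ≤ (1 - ξ) * β ^ (-α) := by rwa [norm_neg]
  exact ⟨eq47 v hρ0 hρ1 hξ'0 hξ hξ1 hlarge hv hζ, eq47 v hρ0 hρ1 hξ'0 hξ hξ1 hlarge hv hζ'⟩

end SmallFieldInputs

end MullerSchiemann1987

end Literature.MathematicalPhysics.QuantumFieldTheory
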